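import Mathlib.NumberTheory.LegendreSymbol.JacobiSymbol
import Mathlib.Data.Nat.Factorization.Basic
import Mathlib.Algebra.Ring.Periodic
import Mathlib.Data.Complex.Basic
import HarnessLib

set_option autoImplicit false

/-!
# Crux `PrintCFram.BottomClassIndexLawFiveLe` (stmt-BirchSwinnertonDyer-20372), line `eisenstein-resource-bdp-line` (registry v24):
# LEMMA D OF THE CUSP SEED, THE FAMILY WEIGHT — square-class invariance, local factorisation and periodicity of
# `N ↦ 𝟙_F(N)·(n/N)` (cell `bsd-print-cfram`, width seat `bsd-line-cfram-p1-w3` g13; THEOREMS ONLY, `--supports` 20372;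
# Mathlib currency; BSD is not proved by any of this)

HONEST FRAMING. Elementary arithmetic of Jacobi symbols (no elliptic curve, no BSD). The family of the cusp seed (crux notes
`Lines/eisenstein-resource-bdp-line-w5g5-cusp-seed.md` §1/§4; the (3,0)-cut of `CuspSeed.cuspSeed_six_of_cutForm`) is the set of
odd negative fundamental discriminants `d = −N` with
`N ≡ 3 (mod 4)`, [`N ≡ 7 (mod 8)` if `2 ∣ m`], `(−N/q) = +1` for every odd prime `q ∣ m`, `3 ∤ N`,
and the quantity to be averaged is the Kronecker symbol `χ_{e* d}(n) = (n/m)(n/N)`. As a function of the squarefree variable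
`N` the weight is `w(N) = 𝟙_F(N) · (n/N)` (Jacobi symbol, Mathlib `J(n | N)`). This file proves the three structural facts the
analytic core (`…CuspSeedSquarefreeDensity`) and the CRT splitting (`…CuspSeedFamilyLocalMeans`) consume:

* `familyWeight_sq_mul`: **square-class invariance** `w(g²·b) = 𝟙_{(g, 6mn)=1} · w(b)` (`g, b ≥ 1`, `n ⊥ m`);
* `familyWeight_eq_sign_mul_prod`: **local factorisation** on the support `N ≡ 3 (mod 4)`: with `n = 2^a n'` (`n'` odd),
  `(n/N) = (2/N)^a · (−1)^{(n'−1)/2} · ∏_{ℓ} (N/ℓ)^{v_ℓ(n)}` (quadratic reciprocity, `(N−1)/2` odd), so that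
  `w(N) = (−1)^{⌊n'/2⌋} · u(N) · ∏_{ℓ ∈ S} λ_ℓ(N)`, `S` = odd primes of `3mn`, `u` a mod-`8` factor, `λ_ℓ` a mod-`ℓ` factor;
* `periodic_familyWeight`: hence `w` is periodic mod `8·∏_{ℓ∈S} ℓ`.

Standard. [folklore]

References: Mathlib `Mathlib.NumberTheory.LegendreSymbol.JacobiSymbol` (`jacobiSym.quadratic_reciprocity`, `mod_left`,
`mod_right'`), `Mathlib.Data.Nat.Factorization.Basic` (`ordCompl`).
-/

-- summit-side namespace `Summit.BirchSwinnertonDyer.BirchSwinnertonDyer.…` (single-conjunct summit, D-0017 layout)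
set_option linter.dupNamespace false

namespace Summit.BirchSwinnertonDyer.BirchSwinnertonDyer.Theorems.PrintCFram.FamilyMean

open Finset
open scoped NumberTheorySymbols Classical

/-! ### §1. Jacobi symbols: products over prime factorisations -/

/-- `J(a | ∏ f_i) = ∏ J(a | f_i)` for non-zero `f_i`. [folklore] -/
theorem jacobiSym_finset_prod_right (a : ℤ) {ι : Type*} (s : Finset ι) (f : ι → ℕ)
    (hf : ∀ i ∈ s, f i ≠ 0) : J(a | ∏ i ∈ s, f i) = ∏ i ∈ s, J(a | f i) := by
  classical
  induction s using Finset.induction_on with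
  | empty => simp [jacobiSym.one_right]
  | insert i s hi ih =>
    rw [Finset.prod_insert hi, Finset.prod_insert hi,
      jacobiSym.mul_right' a (hf i (mem_insert_self _ _))
        (Finset.prod_ne_zero_iff.mpr fun j hj ↦ hf j (mem_insert_of_mem hj)),
      ih fun j hj ↦ hf j (mem_insert_of_mem hj)]

/-- `J(a | t) = ∏_{ℓ ∈ S} J(a | ℓ)^{v_ℓ(t)}` for any finite set `S` of naturals containing the prime factors of `t ≠ 0`. [folklore] -/
theorem jacobiSym_eq_prod_pow_factorization (a : ℤ) {t : ℕ} (ht : t ≠ 0) {S : Finset ℕ}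
    (hS : t.primeFactors ⊆ S) : J(a | t) = ∏ ℓ ∈ S, J(a | ℓ) ^ t.factorization ℓ := by
  have h1 : J(a | t) = ∏ ℓ ∈ t.primeFactors, J(a | ℓ) ^ t.factorization ℓ := by
    conv_lhs => rw [← Nat.prod_factorization_pow_eq_self ht]
    rw [Finsupp.prod, Nat.support_factorization,
      jacobiSym_finset_prod_right a _ _ fun ℓ hℓ ↦ pow_ne_zero _ (Nat.prime_of_mem_primeFactors hℓ).ne_zero]
    exact Finset.prod_congr rfl fun ℓ _ ↦ jacobiSym.pow_right a ℓ _
  rw [h1]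
  refine Finset.prod_subset hS fun ℓ _ hℓt ↦ ?_
  rw [← Nat.support_factorization, Finsupp.notMem_support_iff] at hℓt
  rw [hℓt, pow_zero]

/-! ### §2. Square-class invariance of the family weight -/

/-- **`w(g²b) = 𝟙_{(g,6mn)=1}·w(b)`** for the cusp-seed family weight
`w(N) = 𝟙[N ≡ 3 (4) ∧ (2∣m → N ≡ 7 (8)) ∧ (∀ odd primes q ∣ m, (−N/q) = 1) ∧ 3 ∤ N] · (n/N)` (`g, b ≥ 1`; any `m, n`): an odd
`g` prime to `3mn` changes none of the conditions (`g² ≡ 1 (8)`, `(−g²b/q) = (−b/q)`, `(n/g²b) = (n/b)`), while a prime of `g`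
dividing `2`, `3`, `m` resp. `n` kills the congruence, the `3`-condition, a Legendre condition resp. the symbol `(n/g²b)`.
[folklore] -/
theorem familyWeight_sq_mul (m n : ℕ) {g b : ℕ} (hg : g ≠ 0) (hb : b ≠ 0) :
    (if (g ^ 2 * b) % 4 = 3 ∧ (2 ∣ m → (g ^ 2 * b) % 8 = 7) ∧
        (∀ q : ℕ, q.Prime → q ∣ m → q ≠ 2 → J(-((g ^ 2 * b : ℕ) : ℤ) | q) = 1) ∧ ¬ 3 ∣ g ^ 2 * b
      then (J(((n : ℕ) : ℤ) | g ^ 2 * b) : ℂ) else 0) =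
    if g.Coprime (6 * m * n) then
      (if b % 4 = 3 ∧ (2 ∣ m → b % 8 = 7) ∧
        (∀ q : ℕ, q.Prime → q ∣ m → q ≠ 2 → J(-((b : ℕ) : ℤ) | q) = 1) ∧ ¬ 3 ∣ b
      then (J(((n : ℕ) : ℤ) | b) : ℂ) else 0)
    else 0 := by
  have hneg : ∀ q : ℕ, J(-((g ^ 2 * b : ℕ) : ℤ) | q) = J((g : ℤ) | q) ^ 2 * J(-((b : ℕ) : ℤ) | q) := by
    intro q
    rw [show (-((g ^ 2 * b : ℕ) : ℤ)) = (g : ℤ) ^ 2 * (-((b : ℕ) : ℤ)) by push_cast; ring,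
      jacobiSym.mul_left, jacobiSym.pow_left]
  have hnJ : J(((n : ℕ) : ℤ) | g ^ 2 * b) = J(((n : ℕ) : ℤ) | g) ^ 2 * J(((n : ℕ) : ℤ) | b) := by
    rw [jacobiSym.mul_right' _ (pow_ne_zero 2 hg) hb, jacobiSym.pow_right]
  by_cases hcop : g.Coprime (6 * m * n)
  · -- `g` odd, prime to `3`, `m`, `n`: nothing changes
    rw [if_pos hcop]
    have hg2 : Odd g := Nat.coprime_two_right.mp
      (Nat.Coprime.coprime_dvd_right (⟨3 * m * n, by ring⟩ : 2 ∣ 6 * m * n) hcop)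
    have hg3 : ¬ 3 ∣ g := (Nat.Prime.coprime_iff_not_dvd Nat.prime_three).mp
      (Nat.Coprime.coprime_dvd_right (⟨2 * m * n, by ring⟩ : 3 ∣ 6 * m * n) hcop).symm
    have hgm : g.Coprime m := Nat.Coprime.coprime_dvd_right ⟨6 * n, by ring⟩ hcop
    have hgn : g.Coprime n := Nat.Coprime.coprime_dvd_right ⟨6 * m, by ring⟩ hcop
    -- an odd square is `1 mod 8` (the tree's `EllipticCurves.ModularForms.sq_mod_eight_of_odd`, not imported)
    have hg8 : g ^ 2 % 8 = 1 := by
      have h : g % 8 = 1 ∨ g % 8 = 3 ∨ g % 8 = 5 ∨ g % 8 = 7 := by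
        rw [Nat.odd_iff] at hg2
        omega
      rw [Nat.pow_mod]
      rcases h with h | h | h | h <;> simp [h]
    have h8 : (g ^ 2 * b) % 8 = b % 8 := by
      rw [Nat.mul_mod, hg8, one_mul, Nat.mod_mod]
    have h4 : (g ^ 2 * b) % 4 = b % 4 := by
      rw [← Nat.mod_mod_of_dvd (g ^ 2 * b) (by norm_num : 4 ∣ 8), h8,
        Nat.mod_mod_of_dvd b (by norm_num : 4 ∣ 8)]
    have hq : ∀ q : ℕ, q.Prime → q ∣ m →
        J(-((g ^ 2 * b : ℕ) : ℤ) | q) = J(-((b : ℕ) : ℤ) | q) := by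
      intro q hq hqm
      have hgq : Int.gcd (g : ℤ) (q : ℤ) = 1 := by
        rw [Int.gcd_natCast_natCast]
        exact Nat.Coprime.coprime_dvd_right hqm hgm
      rw [hneg q, jacobiSym.sq_one hgq, one_mul]
    have h3 : (3 ∣ g ^ 2 * b) ↔ 3 ∣ b := by
      refine ⟨fun h ↦ ?_, fun h ↦ dvd_mul_of_dvd_right h _⟩
      rcases (Nat.Prime.dvd_mul Nat.prime_three).mp h with h' | h'
      · exact absurd (Nat.Prime.dvd_of_dvd_pow Nat.prime_three h') hg3
      · exact h'
    have hJ : J(((n : ℕ) : ℤ) | g ^ 2 * b) = J(((n : ℕ) : ℤ) | b) := by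
      have hng : Int.gcd ((n : ℕ) : ℤ) (g : ℤ) = 1 := by
        rw [Int.gcd_natCast_natCast]
        exact hgn.symm
      rw [hnJ, jacobiSym.sq_one hng, one_mul]
    have hiff : ((g ^ 2 * b) % 4 = 3 ∧ (2 ∣ m → (g ^ 2 * b) % 8 = 7) ∧
        (∀ q : ℕ, q.Prime → q ∣ m → q ≠ 2 → J(-((g ^ 2 * b : ℕ) : ℤ) | q) = 1) ∧ ¬ 3 ∣ g ^ 2 * b) ↔
        (b % 4 = 3 ∧ (2 ∣ m → b % 8 = 7) ∧
        (∀ q : ℕ, q.Prime → q ∣ m → q ≠ 2 → J(-((b : ℕ) : ℤ) | q) = 1) ∧ ¬ 3 ∣ b) := by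
      rw [h8, h4, h3]
      refine and_congr_right fun _ ↦ and_congr_right fun _ ↦ and_congr_left fun _ ↦ ?_
      refine forall_congr' fun q ↦ forall_congr' fun hq' ↦ forall_congr' fun hqm ↦
        forall_congr' fun _ ↦ ?_
      rw [hq q hq' hqm]
    by_cases hPb : (b % 4 = 3 ∧ (2 ∣ m → b % 8 = 7) ∧
        (∀ q : ℕ, q.Prime → q ∣ m → q ≠ 2 → J(-((b : ℕ) : ℤ) | q) = 1) ∧ ¬ 3 ∣ b)
    · rw [if_pos hPb, if_pos (hiff.mpr hPb), hJ]
    · rw [if_neg hPb, if_neg (mt hiff.mp hPb)]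
  · -- a prime of `g` dividing `6mn` kills the weight
    rw [if_neg hcop]
    obtain ⟨r, hr, hrg, hr6⟩ := Nat.Prime.not_coprime_iff_dvd.mp hcop
    split_ifs with hP
    · obtain ⟨hP4, -, hPq, hP3⟩ := hP
      have hg2 : ¬ 2 ∣ g := by
        intro h2
        have h4 : 4 ∣ g ^ 2 * b := dvd_mul_of_dvd_left (by
          obtain ⟨k, rfl⟩ := h2
          exact ⟨k ^ 2, by ring⟩) b
        omega
      have hg3 : ¬ 3 ∣ g := fun h3 ↦ hP3 (dvd_mul_of_dvd_left (dvd_pow h3 two_ne_zero) b)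
      rcases (Nat.Prime.dvd_mul hr).mp hr6 with hr6m | hrn
      · rcases (Nat.Prime.dvd_mul hr).mp hr6m with hr6' | hrm
        · -- `r ∣ 6`: `r = 2` or `r = 3`
          exfalso
          have hr' : r ∣ 2 * 3 := by simpa using hr6'
          rcases (Nat.Prime.dvd_mul hr).mp hr' with hr2 | hr3
          · exact hg2 (((Nat.prime_dvd_prime_iff_eq hr Nat.prime_two).mp hr2) ▸ hrg)
          · exact hg3 (((Nat.prime_dvd_prime_iff_eq hr Nat.prime_three).mp hr3) ▸ hrg)
        · -- `r ∣ m`, `r` odd: the Legendre condition at `r` fails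
          exfalso
          have hr2 : r ≠ 2 := fun h ↦ hg2 (h ▸ hrg)
          have h0 : J((g : ℤ) | r) = 0 := by
            haveI : NeZero r := ⟨hr.ne_zero⟩
            rw [jacobiSym.eq_zero_iff_not_coprime, Int.gcd_natCast_natCast, Nat.gcd_eq_right hrg]
            exact hr.ne_one
          have := hPq r hr hrm hr2
          rw [hneg r, h0] at this
          simp at this
      · -- `r ∣ n`: `(n / g²b) = 0`
        have h0 : J(((n : ℕ) : ℤ) | g ^ 2 * b) = 0 := by
          haveI : NeZero (g ^ 2 * b) := ⟨mul_ne_zero (pow_ne_zero 2 hg) hb⟩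
          rw [jacobiSym.eq_zero_iff_not_coprime, Int.gcd_natCast_natCast]
          exact Nat.Prime.not_coprime_iff_dvd.mpr
            ⟨r, hr, hrn, dvd_mul_of_dvd_left (dvd_pow hrg two_ne_zero) b⟩
        rw [h0, Int.cast_zero]
    · rfl

/-! ### §3. Local factorisation on the support and periodicity -/

/-- The odd part `n' = n / 2^{v₂(n)}` of `n ≠ 0` is odd. [folklore] -/
theorem odd_ordCompl_two {n : ℕ} (hn : n ≠ 0) : Odd (ordCompl[2] n) :=
  Nat.coprime_two_left.mp (Nat.coprime_ordCompl Nat.prime_two hn)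

/-- The odd prime factors of `n' = n / 2^{v₂(n)}` lie among the odd primes of `3mn`. [folklore] -/
theorem primeFactors_ordCompl_subset {m n : ℕ} (hm : m ≠ 0) (hn : n ≠ 0) :
    (ordCompl[2] n).primeFactors ⊆ (3 * m * n).primeFactors.erase 2 := by
  intro ℓ hℓ
  obtain ⟨hℓp, hℓn', -⟩ := Nat.mem_primeFactors.mp hℓ
  have hℓn : ℓ ∣ n := hℓn'.trans (Nat.ordCompl_dvd n 2)
  have hℓ2 : ℓ ≠ 2 := by
    rintro rfl
    exact (Nat.not_even_iff_odd.mpr (odd_ordCompl_two hn)) (even_iff_two_dvd.mpr hℓn')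
  exact Finset.mem_erase.mpr ⟨hℓ2, Nat.mem_primeFactors.mpr
    ⟨hℓp, dvd_mul_of_dvd_right hℓn _, mul_ne_zero (mul_ne_zero three_ne_zero hm) hn⟩⟩

/-- **Local factorisation of the family weight.** For `m, n ≥ 1`, every `N`, with `S` = the odd primes of `3mn`,
`n' = n/2^{v₂(n)}`:
`w(N) = (−1)^{⌊n'/2⌋} · u(N) · ∏_{ℓ∈S} λ_ℓ(N)`, where `u(N) = 𝟙[N ≡ 3 (4) ∧ (2∣m → N ≡ 7 (8))]·(2/N)^{v₂(n)}` and
`λ_ℓ(N) = 𝟙[(ℓ = 3 → 3 ∤ N) ∧ (ℓ ∣ m → (−N/ℓ) = 1)]·(N/ℓ)^{v_ℓ(n)}`: on the support `N ≡ 3 (mod 4)` this is quadratic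
reciprocity `(n'/N) = (−1)^{⌊n'/2⌋⌊N/2⌋}(N/n')` with `⌊N/2⌋` odd, and `(N/n') = ∏_ℓ (N/ℓ)^{v_ℓ(n)}`. [folklore] -/
theorem familyWeight_eq_sign_mul_prod {m n : ℕ} (hm : m ≠ 0) (hn : n ≠ 0) (N : ℕ) :
    (if N % 4 = 3 ∧ (2 ∣ m → N % 8 = 7) ∧
        (∀ q : ℕ, q.Prime → q ∣ m → q ≠ 2 → J(-((N : ℕ) : ℤ) | q) = 1) ∧ ¬ 3 ∣ N
      then (J(((n : ℕ) : ℤ) | N) : ℂ) else 0) =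
    (-1 : ℂ) ^ (ordCompl[2] n / 2) *
      (if N % 4 = 3 ∧ (2 ∣ m → N % 8 = 7) then (J(2 | N) : ℂ) ^ n.factorization 2 else 0) *
      ∏ ℓ ∈ (3 * m * n).primeFactors.erase 2,
        (if (ℓ = 3 → ¬ 3 ∣ N) ∧ (ℓ ∣ m → J(-((N : ℕ) : ℤ) | ℓ) = 1)
          then (J(((N : ℕ) : ℤ) | ℓ) : ℂ) ^ n.factorization ℓ else 0) := by
  set S := (3 * m * n).primeFactors.erase 2 with hS
  by_cases h4 : N % 4 = 3 ∧ (2 ∣ m → N % 8 = 7)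
  · have hN4 : N % 4 = 3 := h4.1
    have hNodd : Odd N := Nat.odd_iff.mpr (by omega)
    rw [if_pos h4]
    have hlam : ∀ ℓ ∈ S, (if (ℓ = 3 → ¬ 3 ∣ N) ∧ (ℓ ∣ m → J(-((N : ℕ) : ℤ) | ℓ) = 1)
          then (J(((N : ℕ) : ℤ) | ℓ) : ℂ) ^ n.factorization ℓ else 0) =
        (if (ℓ = 3 → ¬ 3 ∣ N) ∧ (ℓ ∣ m → J(-((N : ℕ) : ℤ) | ℓ) = 1) then (1 : ℂ) else 0) *
          (J(((N : ℕ) : ℤ) | ℓ) : ℂ) ^ n.factorization ℓ := fun ℓ _ ↦ by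
      split_ifs <;> simp
    rw [Finset.prod_congr rfl hlam, Finset.prod_mul_distrib, Finset.prod_boole]
    -- the indicator
    have hind : (∀ ℓ ∈ S, (ℓ = 3 → ¬ 3 ∣ N) ∧ (ℓ ∣ m → J(-((N : ℕ) : ℤ) | ℓ) = 1)) ↔
        ((∀ q : ℕ, q.Prime → q ∣ m → q ≠ 2 → J(-((N : ℕ) : ℤ) | q) = 1) ∧ ¬ 3 ∣ N) := by
      have h3S : 3 ∈ S := Finset.mem_erase.mpr ⟨by norm_num, Nat.mem_primeFactors.mpr
        ⟨Nat.prime_three, ⟨m * n, by ring⟩, mul_ne_zero (mul_ne_zero three_ne_zero hm) hn⟩⟩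
      constructor
      · intro H
        refine ⟨fun q hq hqm hq2 ↦ ?_, (H 3 h3S).1 rfl⟩
        have hqS : q ∈ S := Finset.mem_erase.mpr ⟨hq2, Nat.mem_primeFactors.mpr
          ⟨hq, dvd_mul_of_dvd_left (dvd_mul_of_dvd_right hqm 3) n,
            mul_ne_zero (mul_ne_zero three_ne_zero hm) hn⟩⟩
        exact (H q hqS).2 hqm
      · rintro ⟨Hq, H3⟩ ℓ hℓ
        obtain ⟨hℓ2, hℓ'⟩ := Finset.mem_erase.mp hℓ
        have hℓp : ℓ.Prime := Nat.prime_of_mem_primeFactors hℓ'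
        exact ⟨fun _ ↦ H3, fun hℓm ↦ Hq ℓ hℓp hℓm hℓ2⟩
    -- the Jacobi product is `(N/n')`
    have hn'0 : ordCompl[2] n ≠ 0 := (Nat.ordCompl_pos 2 hn).ne'
    have hJprod : ∏ ℓ ∈ S, (J(((N : ℕ) : ℤ) | ℓ) : ℂ) ^ n.factorization ℓ =
        (J(((N : ℕ) : ℤ) | ordCompl[2] n) : ℂ) := by
      rw [jacobiSym_eq_prod_pow_factorization ((N : ℕ) : ℤ) hn'0 (primeFactors_ordCompl_subset hm hn)]
      push_cast
      refine Finset.prod_congr rfl fun ℓ hℓ ↦ ?_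
      rw [Nat.factorization_ordCompl, Finsupp.erase_ne (Finset.ne_of_mem_erase hℓ)]
    -- reciprocity
    have hrec : (J(((n : ℕ) : ℤ) | N) : ℂ) = (J(2 | N) : ℂ) ^ n.factorization 2 *
        (-1 : ℂ) ^ (ordCompl[2] n / 2) * J(((N : ℕ) : ℤ) | ordCompl[2] n) := by
      have hsplit : ((n : ℕ) : ℤ) = 2 ^ n.factorization 2 * ((ordCompl[2] n : ℕ) : ℤ) := by
        conv_lhs => rw [← Nat.ordProj_mul_ordCompl_eq_self n 2]
        push_cast
        ring
      rw [hsplit, jacobiSym.mul_left, jacobiSym.pow_left,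
        jacobiSym.quadratic_reciprocity (odd_ordCompl_two hn) hNodd]
      have hN2 : Odd (N / 2) := Nat.odd_iff.mpr (by omega)
      have hpow : (-1 : ℤ) ^ (ordCompl[2] n / 2 * (N / 2)) = (-1) ^ (ordCompl[2] n / 2) := by
        rw [mul_comm, pow_mul, hN2.neg_one_pow]
      rw [hpow]
      push_cast
      ring
    by_cases hc : (∀ q : ℕ, q.Prime → q ∣ m → q ≠ 2 → J(-((N : ℕ) : ℤ) | q) = 1) ∧ ¬ 3 ∣ N
    · rw [if_pos ⟨h4.1, h4.2, hc.1, hc.2⟩, if_pos (hind.mpr hc), hJprod, hrec]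
      ring
    · rw [if_neg (fun h ↦ hc ⟨h.2.2.1, h.2.2.2⟩), if_neg (mt hind.mp hc)]
      simp
  · rw [if_neg h4, if_neg (fun h ↦ h4 ⟨h.1, h.2.1⟩)]
    simp

/-- The mod-`8` block `u(N) = 𝟙[N ≡ 3 (4) ∧ (2∣m → N ≡ 7 (8))]·(2/N)^v` is periodic mod `8`. [folklore] -/
theorem periodic_eight_block (m v : ℕ) :
    Function.Periodic (fun N : ℕ ↦
      if N % 4 = 3 ∧ (2 ∣ m → N % 8 = 7) then (J(2 | N) : ℂ) ^ v else 0) 8 := by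
  intro N
  dsimp only
  have h8 : (N + 8) % 8 = N % 8 := by omega
  have h4 : (N + 8) % 4 = N % 4 := by omega
  rw [h8, h4]
  by_cases hc : N % 4 = 3 ∧ (2 ∣ m → N % 8 = 7)
  · rw [if_pos hc, if_pos hc]
    have hodd : Odd N := Nat.odd_iff.mpr (by omega)
    have hodd' : Odd (N + 8) := Nat.odd_iff.mpr (by omega)
    have h1 := jacobiSym.mod_right (2 : ℤ) hodd
    have h2 := jacobiSym.mod_right (2 : ℤ) hodd'
    norm_num at h1 h2
    rw [h1, h2]
  · rw [if_neg hc, if_neg hc]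

/-- The block `λ_ℓ(N) = 𝟙[(ℓ = 3 → 3 ∤ N) ∧ (ℓ ∣ m → (−N/ℓ) = 1)]·(N/ℓ)^v` is periodic mod `ℓ` (`ℓ ≥ 1`; for `ℓ = 3` the
clause `3 ∤ N` is `3`-periodic). [folklore] -/
theorem periodic_prime_block (m ℓ v : ℕ) :
    Function.Periodic (fun N : ℕ ↦
      if (ℓ = 3 → ¬ 3 ∣ N) ∧ (ℓ ∣ m → J(-((N : ℕ) : ℤ) | ℓ) = 1)
        then (J(((N : ℕ) : ℤ) | ℓ) : ℂ) ^ v else 0) ℓ := by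
  intro N
  dsimp only
  have hneg : J(-((N + ℓ : ℕ) : ℤ) | ℓ) = J(-((N : ℕ) : ℤ) | ℓ) := by
    refine jacobiSym.mod_left' ?_
    rw [show (-((N + ℓ : ℕ) : ℤ)) = -((N : ℕ) : ℤ) + (ℓ : ℤ) * (-1) by push_cast; ring,
      Int.add_mul_emod_self_left]
  have hpos : J(((N + ℓ : ℕ) : ℤ) | ℓ) = J(((N : ℕ) : ℤ) | ℓ) := by
    refine jacobiSym.mod_left' ?_
    rw [show (((N + ℓ : ℕ) : ℤ)) = ((N : ℕ) : ℤ) + (ℓ : ℤ) * 1 by push_cast; ring,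
      Int.add_mul_emod_self_left]
  have h3 : (ℓ = 3 → ¬ 3 ∣ N + ℓ) ↔ (ℓ = 3 → ¬ 3 ∣ N) := by
    refine ⟨fun h hℓ ↦ ?_, fun h hℓ ↦ ?_⟩
    · have := h hℓ
      subst hℓ
      rwa [Nat.dvd_add_self_right] at this
    · have := h hℓ
      subst hℓ
      rwa [Nat.dvd_add_self_right]
  rw [hneg, hpos]
  simp only [h3]

/-- **Periodicity of the family weight**: `w(N + 8·∏_{ℓ∈S} ℓ) = w(N)`, `S` = the odd primes of `3mn` (`m, n ≥ 1`). [folklore] -/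
theorem periodic_familyWeight {m n : ℕ} (hm : m ≠ 0) (hn : n ≠ 0) :
    Function.Periodic (fun N : ℕ ↦
      if N % 4 = 3 ∧ (2 ∣ m → N % 8 = 7) ∧
          (∀ q : ℕ, q.Prime → q ∣ m → q ≠ 2 → J(-((N : ℕ) : ℤ) | q) = 1) ∧ ¬ 3 ∣ N
        then (J(((n : ℕ) : ℤ) | N) : ℂ) else 0)
      (8 * ∏ ℓ ∈ (3 * m * n).primeFactors.erase 2, ℓ) := by
  set S := (3 * m * n).primeFactors.erase 2 with hS
  set Q := 8 * ∏ ℓ ∈ S, ℓ with hQ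
  -- the mod-8 block, as a `Q`-periodic function
  have hu : Function.Periodic (fun N : ℕ ↦
      if N % 4 = 3 ∧ (2 ∣ m → N % 8 = 7) then (J(2 | N) : ℂ) ^ n.factorization 2 else 0) Q := by
    have h := (periodic_eight_block m (n.factorization 2)).nat_mul (∏ ℓ ∈ S, ℓ)
    simp only [Nat.cast_id] at h
    rwa [show (∏ ℓ ∈ S, ℓ) * 8 = Q by rw [hQ, mul_comm]] at h
  -- the product of the prime blocks, as a `Q`-periodic function
  have hP : Function.Periodic (∏ ℓ ∈ S, fun N : ℕ ↦
      if (ℓ = 3 → ¬ 3 ∣ N) ∧ (ℓ ∣ m → J(-((N : ℕ) : ℤ) | ℓ) = 1)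
        then (J(((N : ℕ) : ℤ) | ℓ) : ℂ) ^ n.factorization ℓ else 0) Q := by
    refine S.periodic_prod fun ℓ hℓ ↦ ?_
    have hdvd : ℓ ∣ Q := dvd_mul_of_dvd_right (Finset.dvd_prod_of_mem _ hℓ) 8
    obtain ⟨e, he⟩ := hdvd
    have h := (periodic_prime_block m ℓ (n.factorization ℓ)).nat_mul e
    simp only [Nat.cast_id] at h
    rwa [show e * ℓ = Q by rw [he, mul_comm]] at h
  intro N
  dsimp only
  rw [familyWeight_eq_sign_mul_prod hm hn (N + Q), familyWeight_eq_sign_mul_prod hm hn N]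
  have hu' := hu N
  have hP' := hP N
  simp only [Finset.prod_apply] at hP'
  dsimp only at hu'
  rw [hu', ← hS, hP']

end Summit.BirchSwinnertonDyer.BirchSwinnertonDyer.Theorems.PrintCFram.FamilyMean
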